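import Mathlib.Analysis.Calculus.LineDeriv.Basic
import Literature.Geometry.Lorentzian.KerrHyperboloidalFlux
import Literature.Geometry.Lorentzian.ChartCalculus
import HarnessLib

/-!
# The Kerr metric in ingoing Kerr–Schild coordinates: smoothness and stationarity of the
# components, the inverse metric, the wave operator in coordinates; proofs of the named facts
# `Kerr.contMDiff_bilin`, `Kerr.contMDiff_timeVector`, `Kerr.isKillingField_stationaryField`

(family `gr`, infrastructure for **gr.S24**; trunk G08 = T-LORENTZ; namespace `Literature.Lorentz.Kerr`)

`KerrSchild.lean` defines the Kerr metric `g = η + 2H ℓ ⊗ ℓ` on the chart domains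
`Kerr.region a r₀ = {r > max r₀ 0} ⊆ E4` and *vendors as named facts* (fields of the hypothesis
class `[Kerr.Facts]`) the analyticity of the sections `x ↦ g_x` (`Kerr.contMDiff_bilin`) and
`x ↦ V_x = −g♯dt*` (`Kerr.contMDiff_timeVector`). `BlackHoles.lean`/`KerrWaveEnergy.lean` state
the wave equation `□_g ψ = 0` (gr.S24) through the prelude's abstract `dalembertian`. This file

* proves that the Kerr–Schild radius `r`, the scalar `H = M r³/(r⁴ + a² z²)`, the null covector
  `ℓ`, its `η`-dual `ℓ♯`, the metric components `x ↦ g_x` and the vector field `V` are `C^n` for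
  every `n ≤ ω` (in particular real-analytic) at every point with `r > 0`
  (`contDiffAt_radius`, `contDiffAt_scalarH`, `contDiffAt_nullCovector`, `contDiffAt_bilin`,
  `contDiffAt_timeVector`; Kerr–Schild 1965, §3; Visser arXiv:0706.0622, (33)–(35));
* **proves the named facts** `Kerr.contMDiff_bilin M a r₀` and `Kerr.contMDiff_timeVector M a r₀`
  for all real `M, a, r₀` (`contMDiff_bilin_holds`, `contMDiff_timeVector_holds`), by the
  chart calculus of `ChartCalculus.lean` (`OpensChart.contMDiffAt_bilinSection_iff`,
  `contMDiffAt_section_iff`), and the named fact `Kerr.isKillingField_stationaryField M a r₀`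
  (`isKillingField_stationaryField_holds`: `∂_{t*}` is Killing, by `OpensChart.leviCivita_const`
  and stationarity `∂_{t*} g = 0` of the components, O'Neill 1983, Ch. 9, Prop. 25); the facts
  stay `def`s (D-0014), their users can now be fed the proofs;
* works with the components `g^{μν} = η^{μν} − 2H ℓ^μ ℓ^ν` (`inverseMetric`) of the explicit
  inverse metric `Kerr.coSharp` of `KerrHyperboloidalFlux.lean` (`g♯p = η♯p − 2H p(ℓ♯) ℓ♯`,
  identified there with the prelude's `♯`, `Kerr.sharp_smoothMetric`): `g⁻¹g = 1` in components
  (`sum_inverseMetric_mul_bilin`), `g♯ℓ = ℓ♯` (`sum_inverseMetric_mul_nullCovectorFun`);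
* proves **stationarity** (`∂_{t*} g = 0`: `fderiv_bilin_basisVector_zero`) and
  **unimodularity** of the Kerr–Schild components (`∑ g^{μν} ∂_v g_{μν} = 0`, i.e. `det g = −1`:
  `sum_inverseMetric_mul_fderiv_bilin`; Kerr–Schild 1965, §2), whence the contracted Christoffel
  symbols are `−∂_μ g^{μκ}` (`sum_christoffel_eq`) and the **divergence form**
  `□_g ψ = ∑_μ ∂_μ(∑_ν g^{μν} ∂_ν Φ)` (`dalembertian_eq_divergence`);
* proves the **coordinate formula for the wave operator of the Kerr metric**
  (`Kerr.dalembertian_eq_sum`): for `ψ : Kerr.region a r₀ → ℝ` with a representative `Φ` of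
  class `C²` at `x`,
  `□_g ψ (x) = ∑_{μν} g^{μν}(x) (∂_μ∂_ν Φ(x) − DΦ(x)(Γ_x(∂_ν, ∂_μ)))`,
  `g^{μν} = η^{μν} − 2H ℓ^μ ℓ^ν` (O'Neill 1983, Ch. 3, display after Def. 50; the Christoffel map
  `Γ` is `OpensChart.christoffel` of the components `Kerr.bilin M a`).

This is the coordinate bridge needed to discharge the named facts `kerr_far_TEnergy_comparison`
and `kerr_finite_speed_of_propagation` of `KerrWaveEnergy.lean` (energy identities for
`□_g ψ = 0` in the ingoing Kerr–Schild chart), which remain prover items.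

## References

* R. P. Kerr, A. Schild, *A new class of vacuum solutions of the Einstein field equations*, 1965,
  §§2–3 (key `KerrSchild1965`).
* M. Visser, *The Kerr spacetime: a brief introduction*, arXiv:0706.0622, (32)–(35) and §5
  (key `arXiv07060622`).
* B. O'Neill, *Semi-Riemannian geometry*, 1983, Ch. 3, Prop. 10, Prop. 13, Lemma 49, Def. 50;
  Ch. 9, Def. 22 and Prop. 25 (Killing fields) (key `ONeill1983`).
* B. O'Neill, *The geometry of Kerr black holes*, 1995, Ch. 2, §2.2 (key `ONeill1995`).
* M. Dafermos, I. Rodnianski, *Lectures on black holes and linear waves*, arXiv:0811.0354, §5.1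
  (key `arXiv08110354`).
-/

noncomputable section

open Set Filter
open scoped ContDiff Topology Manifold

namespace Literature.Geometry.Lorentzian.Kerr

/-! ### Smoothness of the Kerr–Schild components on `{r > 0}` -/

/-- `x ↦ ‖x⃗‖²` is smooth on `E4` (a polynomial). [folklore] -/
theorem contDiff_spatialNorm_sq {n : WithTop ℕ∞} :
    ContDiff ℝ n fun x : E4 ↦ E4.spatialNorm x ^ 2 :=
  (contDiff_norm_sq ℝ).comp E4.spatial.contDiff

/-- The coordinate functions `x ↦ x μ` are smooth on `E4`. [folklore] -/
theorem contDiff_coord (μ : Fin 4) {n : WithTop ℕ∞} : ContDiff ℝ n fun x : E4 ↦ x μ :=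
  (E4.dx μ).contDiff

/-- The discriminant `(ρ² − a²)² + 4 a² z²` under the inner square root of the Kerr–Schild
radius (Visser arXiv:0706.0622, (35)). [cite: arXiv07060622, (35)] -/
def radiusDiscr (a : ℝ) (x : E4) : ℝ :=
  (E4.spatialNorm x ^ 2 - a ^ 2) ^ 2 + 4 * a ^ 2 * x 3 ^ 2

/-- The discriminant is a polynomial, hence smooth. [folklore] -/
theorem contDiff_radiusDiscr (a : ℝ) {n : WithTop ℕ∞} : ContDiff ℝ n (radiusDiscr a) := by
  unfold radiusDiscr
  exact ((contDiff_spatialNorm_sq.sub contDiff_const).pow 2).add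
    (contDiff_const.mul ((contDiff_coord 3).pow 2))

/-- `r = √(((ρ² − a²) + √((ρ² − a²)² + 4a²z²)) / 2)` (the definition, with the discriminant
named; Visser arXiv:0706.0622, (35)). [cite: arXiv07060622, (35)] -/
theorem radius_eq (a : ℝ) (x : E4) :
    radius a x = √(((E4.spatialNorm x ^ 2 - a ^ 2) + √(radiusDiscr a x)) / 2) := rfl

/-- Where `r > 0` the discriminant is positive: if it vanished, `ρ² = a²` and `a z = 0`, whence
`r² = 0` (Visser arXiv:0706.0622, (35)). [cite: arXiv07060622, (35)] -/
theorem radiusDiscr_pos {a : ℝ} {x : E4} (hx : 0 < radius a x) : 0 < radiusDiscr a x := by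
  by_contra h
  have h0 : radiusDiscr a x = 0 := le_antisymm (not_lt.mp h) (radius_discr_nonneg a x)
  have h1 : (E4.spatialNorm x ^ 2 - a ^ 2) ^ 2 = 0 := by
    have := sq_nonneg (E4.spatialNorm x ^ 2 - a ^ 2)
    have h4 : 0 ≤ 4 * a ^ 2 * x 3 ^ 2 := by positivity
    unfold radiusDiscr at h0
    linarith
  have h2 : E4.spatialNorm x ^ 2 - a ^ 2 = 0 := pow_eq_zero_iff (n := 2) (by norm_num) |>.mp h1
  have h3 : radius a x ^ 2 = 0 := by
    rw [radius_sq, show (E4.spatialNorm x ^ 2 - a ^ 2) ^ 2 + 4 * a ^ 2 * x 3 ^ 2 = radiusDiscr a x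
      from rfl, h0, h2, Real.sqrt_zero]
    norm_num
  have : radius a x = 0 := pow_eq_zero_iff (n := 2) (by norm_num) |>.mp h3
  linarith

/-- **The Kerr–Schild radius is `C^n` (every `n ≤ ω`) wherever it is positive**: both square
roots have positive arguments there. Kerr–Schild 1965, §3; Visser arXiv:0706.0622, (35)
("`r` is real-analytic off the disc"). [cite: arXiv07060622, (35)] -/
theorem contDiffAt_radius {a : ℝ} {x : E4} (hx : 0 < radius a x) {n : WithTop ℕ∞} :
    ContDiffAt ℝ n (radius a) x := by
  have hq : ContDiffAt ℝ n
      (fun x ↦ ((E4.spatialNorm x ^ 2 - a ^ 2) + √(radiusDiscr a x)) / 2) x :=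
    ((contDiff_spatialNorm_sq.sub contDiff_const).contDiffAt.add
      ((contDiff_radiusDiscr a).contDiffAt.sqrt (radiusDiscr_pos hx).ne')).div_const 2
  have hpos : ((E4.spatialNorm x ^ 2 - a ^ 2) + √(radiusDiscr a x)) / 2 ≠ 0 := by
    have h := radius_sq a x
    have h2 : 0 < radius a x ^ 2 := by positivity
    rw [h] at h2
    exact h2.ne'
  exact hq.sqrt hpos

/-- **`H = M r³/(r⁴ + a² z²)` is `C^n` wherever `r > 0`** (the denominator is positive).
Visser arXiv:0706.0622, (33). [cite: arXiv07060622, (33)] -/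
theorem contDiffAt_scalarH (M a : ℝ) {x : E4} (hx : 0 < radius a x) {n : WithTop ℕ∞} :
    ContDiffAt ℝ n (scalarH M a) x := by
  unfold scalarH
  have hr := contDiffAt_radius hx (n := n)
  refine (contDiffAt_const.mul (hr.pow 3)).div ((hr.pow 4).add
    (contDiffAt_const.mul ((contDiff_coord 3).contDiffAt.pow 2))) ?_
  positivity

/-- The components `ℓ_μ` of the Kerr–Schild null covector are `C^n` wherever `r > 0`
(rational in `(x, r)` with nonvanishing denominators `r² + a²`, `r`). Visser
arXiv:0706.0622, (34). [cite: arXiv07060622, (34)] -/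
theorem contDiffAt_nullCovectorFun (a : ℝ) {x : E4} (hx : 0 < radius a x) {n : WithTop ℕ∞}
    (μ : Fin 4) : ContDiffAt ℝ n (fun y ↦ nullCovectorFun a y μ) x := by
  have hr := contDiffAt_radius hx (n := n)
  have h1 := (contDiff_coord 1 (n := n)).contDiffAt (x := x)
  have h2 := (contDiff_coord 2 (n := n)).contDiffAt (x := x)
  have h3 := (contDiff_coord 3 (n := n)).contDiffAt (x := x)
  have hra : radius a x ^ 2 + a ^ 2 ≠ 0 := by positivity
  fin_cases μ
  · simp only [nullCovectorFun, Fin.zero_eta, Fin.isValue, Matrix.cons_val_zero]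
    exact contDiffAt_const
  · simp only [nullCovectorFun, Fin.mk_one, Fin.isValue, Matrix.cons_val_one, Matrix.cons_val_zero]
    exact ((hr.mul h1).add (contDiffAt_const.mul h2)).div ((hr.pow 2).add contDiffAt_const) hra
  · simp only [nullCovectorFun, Fin.reduceFinMk, Fin.isValue, Matrix.cons_val]
    exact ((hr.mul h2).sub (contDiffAt_const.mul h1)).div ((hr.pow 2).add contDiffAt_const) hra
  · simp only [nullCovectorFun, Fin.reduceFinMk, Fin.isValue, Matrix.cons_val]
    exact h3.div hr hx.ne'

/-- **The null covector `x ↦ ℓ_x` is `C^n` wherever `r > 0`** (a finite sum `∑ ℓ_μ dx^μ` with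
`C^n` coefficients). Kerr–Schild 1965, §3; Visser arXiv:0706.0622, (34). [cite: arXiv07060622, (34)] -/
theorem contDiffAt_nullCovector (a : ℝ) {x : E4} (hx : 0 < radius a x) {n : WithTop ℕ∞} :
    ContDiffAt ℝ n (nullCovector a) x := by
  have : nullCovector a = fun y ↦ ∑ μ, nullCovectorFun a y μ • E4.dx μ := rfl
  rw [this]
  exact ContDiffAt.sum fun μ _ ↦ (contDiffAt_nullCovectorFun a hx μ).smul contDiffAt_const

/-- `(c α) ⊗ β = c (α ⊗ β)` for covectors (bilinearity of `⊗`). [folklore] -/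
theorem tmul_smul_left (c : ℝ) (α β : E4 →L[ℝ] ℝ) : E4.tmul (c • α) β = c • E4.tmul α β := by
  ext v w
  simp [E4.tmul_apply, mul_assoc]

/-- `g = η + (2H ℓ) ⊗ ℓ` as a function of the point (the scalar moved onto the first factor, a
form convenient for the calculus lemmas). Kerr–Schild 1965, §2. [cite: KerrSchild1965, §2] -/
theorem bilin_eq_fun (M a : ℝ) : bilin M a = fun y ↦ Minkowski.bilin +
    E4.tmul ((2 * scalarH M a y) • nullCovector a y) (nullCovector a y) := by
  funext y
  rw [tmul_smul_left]
  rfl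

/-- **The Kerr–Schild metric components `x ↦ g_x = η + 2H ℓ ⊗ ℓ` are `C^n` (every `n ≤ ω`)
wherever `r > 0`.** Kerr–Schild 1965, §3; Visser arXiv:0706.0622, (32)–(35).
[cite: KerrSchild1965, §3] -/
theorem contDiffAt_bilin (M a : ℝ) {x : E4} (hx : 0 < radius a x) {n : WithTop ℕ∞} :
    ContDiffAt ℝ n (bilin M a) x := by
  have hl := contDiffAt_nullCovector a hx (n := n)
  have hH := contDiffAt_scalarH M a hx (n := n)
  rw [bilin_eq_fun]
  exact contDiffAt_const.add (((contDiffAt_const.mul hH).smul hl).smulRight hl)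

/-- On the chart domains `Kerr.region a r₀ ⊆ {r > 0}` the metric components are differentiable
(the hypothesis of the coordinate formulas of `ChartCalculus.lean`). [cite: KerrSchild1965, §3] -/
theorem differentiableAt_bilin (M a : ℝ) {r₀ : ℝ} (x : region a r₀) :
    DifferentiableAt ℝ (bilin M a) x :=
  (contDiffAt_bilin M a (radius_pos_of_mem_region x.2) (n := 1)).differentiableAt one_ne_zero

/-- The `η`-dual null vector `ℓ♯`, unfolded. [cite: KerrSchild1965, §2] -/
theorem nullVector_eq (a : ℝ) (x : E4) :
    nullVector a x = WithLp.toLp 2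
      (fun μ ↦ if μ = 0 then -nullCovectorFun a x μ else nullCovectorFun a x μ) := rfl

/-- `x ↦ ℓ♯_x` is `C^n` wherever `r > 0` (componentwise). [cite: arXiv07060622, (34)] -/
theorem contDiffAt_nullVector (a : ℝ) {x : E4} (hx : 0 < radius a x) {n : WithTop ℕ∞} :
    ContDiffAt ℝ n (nullVector a) x := by
  rw [contDiffAt_euclidean]
  intro μ
  by_cases hμ : μ = 0
  · subst hμ
    simp only [nullVector_eq, if_true]
    exact (contDiffAt_nullCovectorFun a hx 0).neg
  · simp only [nullVector_eq, hμ, if_false]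
    exact contDiffAt_nullCovectorFun a hx μ

/-- **`x ↦ V_x = ∂_{t*} − 2H ℓ♯` is `C^n` (every `n ≤ ω`) wherever `r > 0`.**
Dafermos–Rodnianski arXiv:0811.0354, §5.1. [cite: arXiv08110354, §5.1] -/
theorem contDiffAt_timeVector (M a : ℝ) {x : E4} (hx : 0 < radius a x) {n : WithTop ℕ∞} :
    ContDiffAt ℝ n (timeVector M a) x := by
  unfold timeVector
  exact contDiffAt_const.sub ((contDiffAt_const.mul (contDiffAt_scalarH M a hx)).smul
    (contDiffAt_nullVector a hx))

/-! ### Proofs of the named facts `Kerr.contMDiff_timeVector` and `Kerr.contMDiff_bilin` -/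

/-- **Proof of the named fact `Kerr.contMDiff_timeVector`** (field of `[Kerr.Facts]`): the
vector field `x ↦ V_x = −g♯(dt*)` is a real-analytic section of `T(Kerr.region a r₀)`, for all
real `M, a, r₀`. By `OpensChart.contMDiffAt_section_iff`/`contMDiffAt_iff` this is the
analyticity of `timeVector M a` at points with `r > 0` (`contDiffAt_timeVector`).
Dafermos–Rodnianski arXiv:0811.0354, §5.1. [cite: arXiv08110354, §5.1] -/
theorem contMDiff_timeVector_holds (M a r₀ : ℝ) : contMDiff_timeVector M a r₀ := by
  intro x
  rw [ModelWithCorners.tangent]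
  rw [OpensChart.contMDiffAt_section_iff x
      (fun y : region a r₀ ↦ (timeVector M a y.1 : TangentSpace 𝓘(ℝ, E4) y)),
    OpensChart.contMDiffAt_iff x _ (timeVector M a) (fun _ ↦ rfl)]
  exact contDiffAt_timeVector M a (radius_pos_of_mem_region x.2)

/-- **Proof of the named fact `Kerr.contMDiff_bilin`** (field of `[Kerr.Facts]`): the section
`x ↦ g_{M,a}(x)` of the bundle of bilinear forms on `T(Kerr.region a r₀)` is real-analytic, for
all real `M, a, r₀`. By `OpensChart.contMDiffAt_bilinSection_iff` this is the analyticity of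
`Kerr.bilin M a` at points with `r > 0` (`contDiffAt_bilin`). Kerr–Schild 1965, §3; Visser
arXiv:0706.0622, (33)–(35). [cite: KerrSchild1965, §3] -/
theorem contMDiff_bilin_holds (M a r₀ : ℝ) : contMDiff_bilin M a r₀ := by
  intro x
  rw [OpensChart.contMDiffAt_bilinSection_iff x _ (bilin M a) (fun _ ↦ rfl)]
  exact contDiffAt_bilin M a (radius_pos_of_mem_region x.2)

/-! ### The inverse Kerr–Schild metric, componentwise -/

/-- Expansion of a vector of `E4` in the coordinate basis: `w = ∑ w^μ ∂_μ`. [folklore] -/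
theorem eq_sum_basisVector (w : E4) : w = ∑ μ, w μ • E4.basisVector μ := by
  conv_lhs => rw [← (EuclideanSpace.basisFun (Fin 4) ℝ).sum_repr w]
  simp [EuclideanSpace.basisFun_apply]

/-- The **components of the inverse Kerr metric** in Kerr–Schild coordinates,
`g^{μν}(x) = dx^μ(g♯ dx^ν)`, through the explicit inverse `Kerr.coSharp`
(`g♯p = η♯p − 2H p(ℓ♯) ℓ♯`, `KerrHyperboloidalFlux.lean`): `g^{μν} = η^{μν} − 2H ℓ^μ ℓ^ν`.
Kerr–Schild 1965, §2; Visser arXiv:0706.0622, §5. [cite: KerrSchild1965, §2] -/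
def inverseMetric (M a : ℝ) (x : E4) (μ ν : Fin 4) : ℝ :=
  coSharp M a x (E4.dx ν : E4 →L[ℝ] ℝ) μ

/-- Explicit components: `g^{μν} = η^{μν} − 2H ℓ^μ ℓ^ν` with `η^{μν} = diag(−1, 1, 1, 1)` and
`ℓ^μ = (ℓ♯)^μ`. Visser arXiv:0706.0622, §5. [cite: arXiv07060622, §5] -/
theorem inverseMetric_apply (M a : ℝ) (x : E4) (μ ν : Fin 4) :
    inverseMetric M a x μ ν =
      (if μ = ν then (if μ = 0 then -1 else 1) else 0) -
        2 * scalarH M a x * nullVector a x ν * nullVector a x μ := by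
  simp only [inverseMetric, coSharp, etaSharp, ContinuousLinearMap.coe_coe]
  fin_cases μ <;> fin_cases ν <;> simp [E4.basisVector]
  ring

/-- The dual-basis coordinate of the standard basis of `E4` is the coordinate covector:
`(basisFun).coord μ v = v μ`. [folklore] -/
theorem coord_basisFun (μ : Fin 4) (v : E4) :
    (EuclideanSpace.basisFun (Fin 4) ℝ).toBasis.coord μ v = v μ := by
  simp [Module.Basis.coord]

/-- `(basisFun).coord μ = dx^μ` as linear maps. [folklore] -/
theorem coord_basisFun_eq (μ : Fin 4) :
    (EuclideanSpace.basisFun (Fin 4) ℝ).toBasis.coord μ =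
      ((E4.dx μ : E4 →L[ℝ] ℝ) : E4 →ₗ[ℝ] ℝ) := by
  ext v
  rw [coord_basisFun]
  rfl

/-- The coefficients of the chart formula `OpensChart.dalembertian_eq_sum` for the Kerr metric
are the components `g^{μν}`. [cite: KerrSchild1965, §2] -/
theorem sharp_dx_apply [Facts] (M a r₀ : ℝ) (x : region a r₀) (ν μ : Fin 4) :
    WithLp.ofLp ((smoothMetric M a r₀).sharp x ((E4.dx ν : E4 →L[ℝ] ℝ) : E4 →ₗ[ℝ] ℝ)) μ =
      inverseMetric M a x μ ν := by
  unfold inverseMetric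
  rw [← sharp_smoothMetric M a r₀ x]

/-! ### The wave operator of the Kerr metric in Kerr–Schild coordinates -/

/-- **The wave operator of the Kerr metric in ingoing Kerr–Schild coordinates.** For
`ψ : Kerr.region a r₀ → ℝ` with a representative `Φ : E4 → ℝ` (`ψ y = Φ y`) of class `C²` at `x`,
`□_g ψ (x) = ∑_{μ,ν} g^{μν}(x) (∂_μ∂_ν Φ(x) − DΦ(x)(Γ_x(∂_ν, ∂_μ)))`, where
`g^{μν} = η^{μν} − 2H ℓ^μ ℓ^ν` (`inverseMetric`) and `Γ_x(X₀, Y₀) = ♯(½K(X₀, Y₀, ·))` is the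
Christoffel map of the components `Kerr.bilin M a` (`OpensChart.christoffel`), i.e. the classical
`□_g ψ = g^{μν}(∂_μ∂_νψ − Γ^λ_{μν} ∂_λ ψ)` (O'Neill 1983, Ch. 3, display after Def. 50) for the
Kerr–Schild components (Kerr–Schild 1965, §2). Here `□_g` is the prelude's
`PseudoRiemannianMetric.dalembertian` of `Kerr.smoothMetric M a r₀` under `[Kerr.Facts]
[Kerr.SliceFacts]`, exactly as in gr.S24 (`IsAdmissibleKerrWave`).
[cite: ONeill1983, Ch. 3, Def. 3.50 ff.] -/
theorem dalembertian_eq_sum [Facts] [SliceFacts] (M a r₀ : ℝ) {ψ : region a r₀ → ℝ}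
    {Φ : E4 → ℝ} (hψ : ∀ y, ψ y = Φ y) (x : region a r₀) (hΦ : ContDiffAt ℝ 2 Φ x) :
    (smoothMetric M a r₀).toPseudoRiemannianMetric.dalembertian ψ x =
      ∑ μ, ∑ ν, inverseMetric M a x μ ν *
        (fderiv ℝ (fderiv ℝ Φ) x (E4.basisVector μ) (E4.basisVector ν) -
          fderiv ℝ Φ x (OpensChart.christoffel (smoothMetric M a r₀).toPseudoRiemannianMetric
            (bilin M a) x (E4.basisVector ν) (E4.basisVector μ))) := by
  have hG : ∀ y : region a r₀,
      (smoothMetric M a r₀).toPseudoRiemannianMetric.val y = bilin M a y := fun y ↦ rfl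
  rw [OpensChart.dalembertian_eq_sum hG (EuclideanSpace.basisFun (Fin 4) ℝ).toBasis x
    (differentiableAt_bilin M a x) hψ hΦ]
  refine Finset.sum_congr rfl fun μ _ ↦ Finset.sum_congr rfl fun ν _ ↦ ?_
  congr 1
  · rw [coord_basisFun, coord_basisFun_eq]
    exact sharp_dx_apply M a r₀ x ν μ
  · simp [OrthonormalBasis.coe_toBasis, EuclideanSpace.basisFun_apply]

/-- **The wave equation of gr.S24 in coordinates.** For an admissible-type wave (`ψ` smooth on
the exterior `Kerr.exterior M a = Kerr.region a r₊`), with `Φ = Function.extend Subtype.val ψ 0`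
its extension by zero (the representative used by `coordEnergyDensity`), `□_g ψ = 0` at `x` is
the coordinate equation `∑ g^{μν}(∂_μ∂_νΦ − DΦ(Γ(∂_ν, ∂_μ))) = 0` at `x`.
[cite: ONeill1983, Ch. 3, Def. 3.50 ff.] -/
theorem dalembertian_extend_eq_sum [Facts] [SliceFacts] (M a r₀ : ℝ) {ψ : region a r₀ → ℝ}
    (hψ : ContMDiff 𝓘(ℝ, E4) 𝓘(ℝ, ℝ) 2 ψ) (x : region a r₀) :
    (smoothMetric M a r₀).toPseudoRiemannianMetric.dalembertian ψ x =
      ∑ μ, ∑ ν, inverseMetric M a x μ ν *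
        (fderiv ℝ (fderiv ℝ (Function.extend Subtype.val ψ 0)) x (E4.basisVector μ)
            (E4.basisVector ν) -
          fderiv ℝ (Function.extend Subtype.val ψ 0) x
            (OpensChart.christoffel (smoothMetric M a r₀).toPseudoRiemannianMetric
              (bilin M a) x (E4.basisVector ν) (E4.basisVector μ))) := by
  have hrep : ∀ y : region a r₀, ψ y = Function.extend Subtype.val ψ 0 y :=
    fun y ↦ (Subtype.val_injective.extend_apply _ _ y).symm
  refine dalembertian_eq_sum M a r₀ hrep x ?_
  exact (OpensChart.contMDiffAt_iff x ψ _ hrep).mp (hψ x)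

/-! ### Stationarity: the components do not depend on `t*`; `∂_{t*}` is a Killing field -/

/-- The spatial part of `x + t ∂_{t*}` is the spatial part of `x`. [folklore] -/
theorem spatial_add_smul_basisVector_zero (x : E4) (t : ℝ) :
    E4.spatial (x + t • E4.basisVector 0) = E4.spatial x := by
  ext i
  simp [E4.spatial_apply, Fin.succ_ne_zero]

/-- The Kerr–Schild radius is invariant under `t*`-translations (it depends on `‖x⃗‖` and `z`
only; Visser arXiv:0706.0622, (35)). The same statement (argument order `(a s x)`) is
`Kerr.radius_add_time_smul_basisVector` of `Literature/Barriers/FinalStateConjecture/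
HairyKerrBifurcation.lean`, which this foundational file does not import (TODO(librarian): hoist
it to `KerrSchild.lean` and deduplicate). [cite: arXiv07060622, (35)] -/
theorem radius_add_time_smul_basisVector (a : ℝ) (x : E4) (t : ℝ) :
    radius a (x + t • E4.basisVector 0) = radius a x := by
  have h3 : (x + t • E4.basisVector 0) 3 = x 3 := by simp
  have hs : E4.spatialNorm (x + t • E4.basisVector 0) = E4.spatialNorm x := by
    simp only [E4.spatialNorm, spatial_add_smul_basisVector_zero]
  simp only [radius, hs, h3]

/-- `H` is invariant under `t*`-translations (Visser arXiv:0706.0622, (33)). [cite: arXiv07060622, (33)] -/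
theorem scalarH_add_smul_basisVector_zero (M a : ℝ) (x : E4) (t : ℝ) :
    scalarH M a (x + t • E4.basisVector 0) = scalarH M a x := by
  have h3 : (x + t • E4.basisVector 0) 3 = x 3 := by simp
  simp only [scalarH, radius_add_time_smul_basisVector, h3]

/-- The components `ℓ_μ` are invariant under `t*`-translations (Visser arXiv:0706.0622, (34)).
[cite: arXiv07060622, (34)] -/
theorem nullCovectorFun_add_smul_basisVector_zero (a : ℝ) (x : E4) (t : ℝ) :
    nullCovectorFun a (x + t • E4.basisVector 0) = nullCovectorFun a x := by
  have h1 : (x + t • E4.basisVector 0) 1 = x 1 := by simp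
  have h2 : (x + t • E4.basisVector 0) 2 = x 2 := by simp
  have h3 : (x + t • E4.basisVector 0) 3 = x 3 := by simp
  simp only [nullCovectorFun, radius_add_time_smul_basisVector, h1, h2, h3]

/-- `ℓ` is invariant under `t*`-translations (Visser arXiv:0706.0622, (34)). [cite: arXiv07060622, (34)] -/
theorem nullCovector_add_smul_basisVector_zero (a : ℝ) (x : E4) (t : ℝ) :
    nullCovector a (x + t • E4.basisVector 0) = nullCovector a x := by
  simp only [nullCovector, nullCovectorFun_add_smul_basisVector_zero]

/-- `ℓ♯` is invariant under `t*`-translations. [cite: arXiv07060622, (34)] -/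
theorem nullVector_add_smul_basisVector_zero (a : ℝ) (x : E4) (t : ℝ) :
    nullVector a (x + t • E4.basisVector 0) = nullVector a x := by
  simp only [nullVector_eq, nullCovectorFun_add_smul_basisVector_zero]

/-- **Stationarity of the Kerr–Schild components**: `g_{x + t ∂_{t*}} = g_x` (no component
depends on `t*`). Kerr–Schild 1965, §2; O'Neill 1995, Ch. 2, §2.2. [cite: KerrSchild1965, §2] -/
theorem bilin_add_smul_basisVector_zero (M a : ℝ) (x : E4) (t : ℝ) :
    bilin M a (x + t • E4.basisVector 0) = bilin M a x := by
  simp only [bilin, scalarH_add_smul_basisVector_zero, nullCovector_add_smul_basisVector_zero]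

/-- **`∂_{t*} g = 0`**: the derivative of the components in the direction `∂_{t*}` vanishes
wherever they are differentiable (the line `t ↦ x + t ∂_{t*}` is mapped to a constant).
[cite: KerrSchild1965, §2] -/
theorem fderiv_bilin_basisVector_zero (M a : ℝ) {x : E4} (hx : DifferentiableAt ℝ (bilin M a) x) :
    fderiv ℝ (bilin M a) x (E4.basisVector 0) = 0 := by
  have h1 : HasLineDerivAt ℝ (bilin M a) (fderiv ℝ (bilin M a) x (E4.basisVector 0)) x
      (E4.basisVector 0) := hx.hasFDerivAt.hasLineDerivAt _
  have h2 : HasLineDerivAt ℝ (bilin M a) 0 x (E4.basisVector 0) := by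
    have : (fun t : ℝ ↦ bilin M a (x + t • E4.basisVector 0)) = fun _ ↦ bilin M a x :=
      funext fun t ↦ bilin_add_smul_basisVector_zero M a x t
    show HasDerivAt (fun t : ℝ ↦ bilin M a (x + t • E4.basisVector 0)) 0 0
    rw [this]
    exact hasDerivAt_const (0 : ℝ) (bilin M a x)
  exact h1.unique h2

/-- The derivative of the (symmetric) components is symmetric: `DG(x)(v)(A, B) = DG(x)(v)(B, A)`.
[cite: KerrSchild1965, §2] -/
theorem fderiv_bilin_symm (M a : ℝ) {x : E4} (hx : DifferentiableAt ℝ (bilin M a) x)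
    (v A B : E4) : fderiv ℝ (bilin M a) x v A B = fderiv ℝ (bilin M a) x v B A := by
  rw [← OpensChart.fderiv_apply₂ (bilin M a) hx, ← OpensChart.fderiv_apply₂ (bilin M a) hx]
  congr 2
  funext y
  exact bilin_symm M a y A B

/-- **Proof of the named fact `Kerr.isKillingField_stationaryField`**: `∂_{t*}` is a Killing
field of the Kerr metric on every chart domain, for all real `M, a, r₀`. The constant section is
analytic (`OpensChart.contMDiffAt_section_iff`); the Killing equation
`g(∇_{Y₀} ∂_t, Z₀) + g(Y₀, ∇_{Z₀} ∂_t) = 0` reduces by `OpensChart.leviCivita_const` and the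
Koszul form to `∂_{t*} g(Y₀, Z₀) = 0` (`fderiv_bilin_basisVector_zero`), all other terms
cancelling by symmetry. O'Neill 1983, Ch. 9, Prop. 25 (`X` Killing iff `𝓛_X g = 0`, which for a
coordinate field is `∂_t g_{ij} = 0`); O'Neill 1995, Ch. 2, §2.2. [cite: ONeill1983, Ch. 9, Prop. 9.25] -/
theorem isKillingField_stationaryField_holds [Facts] (M a r₀ : ℝ) :
    isKillingField_stationaryField M a r₀ := by
  intro _inst
  refine ⟨fun x ↦ ?_, fun x Y₀ Z₀ ↦ ?_⟩
  · rw [ModelWithCorners.tangent, OpensChart.contMDiffAt_section_iff x (stationaryField a r₀)]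
    exact contMDiffAt_const
  · have hG : ∀ y : region a r₀, (metric M a r₀).toPseudoRiemannianMetric.val y = bilin M a y :=
      fun y ↦ rfl
    have hGx := differentiableAt_bilin M a x
    have hlc : ∀ W : E4, (metric M a r₀).toPseudoRiemannianMetric.leviCivita (stationaryField a r₀)
        x W = OpensChart.christoffel (metric M a r₀).toPseudoRiemannianMetric (bilin M a) x
          (E4.basisVector 0) W :=
      fun W ↦ OpensChart.leviCivita_const_apply hG x hGx (E4.basisVector 0) W
    rw [hlc, hlc, (metric M a r₀).symm x Y₀]
    have h2 := OpensChart.two_mul_val_christoffel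
      (g := (metric M a r₀).toPseudoRiemannianMetric) (G := bilin M a) x (E4.basisVector 0) Y₀ Z₀
    have h3 := OpensChart.two_mul_val_christoffel
      (g := (metric M a r₀).toPseudoRiemannianMetric) (G := bilin M a) x (E4.basisVector 0) Z₀ Y₀
    simp only [OpensChart.koszulForm_apply, fderiv_bilin_basisVector_zero M a hGx,
      zero_apply] at h2 h3
    have h4 := fderiv_bilin_symm M a hGx Y₀ (E4.basisVector 0) Z₀
    have h5 := fderiv_bilin_symm M a hGx Z₀ (E4.basisVector 0) Y₀
    linarith

/-! ### Unimodularity: `g^{μν} ∂_λ g_{μν} = 0` (the Kerr–Schild coordinates have `det g = −1`) -/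

/-- The Minkowski components `η_{μν} = η^{μν} = diag(−1, 1, 1, 1)`. [cite: ONeill1983, Ch. 3, p. 55] -/
def etaComp (μ ν : Fin 4) : ℝ := if μ = ν then (if μ = 0 then -1 else 1) else 0

/-- `η(∂_μ, ∂_ν) = η_{μν}`. [cite: ONeill1983, Ch. 3, p. 55] -/
theorem minkowski_bilin_basisVector (μ ν : Fin 4) :
    Minkowski.bilin (E4.basisVector μ) (E4.basisVector ν) = etaComp μ ν := by
  fin_cases μ <;> fin_cases ν <;> simp [etaComp, E4.basisVector, Fin.sum_univ_three]

/-- `ℓ(∂_μ) = ℓ_μ`. [cite: arXiv07060622, (34)] -/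
theorem nullCovector_basisVector (a : ℝ) (x : E4) (μ : Fin 4) :
    nullCovector a x (E4.basisVector μ) = nullCovectorFun a x μ := by
  fin_cases μ <;> simp [nullCovector, E4.covector_apply, E4.basisVector]

/-- **The metric components** `g_{μν} = g(∂_μ, ∂_ν) = η_{μν} + 2H ℓ_μ ℓ_ν` (Kerr–Schild 1965, §2;
Visser arXiv:0706.0622, (32)). [cite: KerrSchild1965, §2] -/
theorem bilin_basisVector (M a : ℝ) (x : E4) (μ ν : Fin 4) :
    bilin M a x (E4.basisVector μ) (E4.basisVector ν) =
      etaComp μ ν + 2 * scalarH M a x * nullCovectorFun a x μ * nullCovectorFun a x ν := by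
  rw [bilin_apply, minkowski_bilin_basisVector, nullCovector_basisVector, nullCovector_basisVector]
  ring

/-- The components of `ℓ♯`: `(ℓ♯)^μ = η^{μμ} ℓ_μ`. [cite: KerrSchild1965, §2] -/
theorem nullVector_apply (a : ℝ) (x : E4) (μ : Fin 4) :
    nullVector a x μ = (if μ = 0 then -1 else 1) * nullCovectorFun a x μ := by
  simp only [nullVector_eq]
  split_ifs <;> simp

/-- `ℓ` is null: `∑_μ (ℓ♯)^μ ℓ_μ = ℓ(ℓ♯) = 0` wherever `r > 0`, componentwise.
[cite: KerrSchild1965, §2] -/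
theorem sum_nullVector_mul_nullCovectorFun {a : ℝ} {x : E4} (hx : 0 < radius a x) :
    ∑ μ, nullVector a x μ * nullCovectorFun a x μ = 0 := by
  have h := nullCovector_nullVector hx
  rw [nullCovector, E4.covector_apply] at h
  simpa [mul_comm] using h

/-- **Raising the index of `ℓ` with `g` gives `ℓ♯`**: `∑_μ g^{μν} ℓ_μ = (ℓ♯)^ν` (`g♯ℓ = η♯ℓ` as
`ℓ(ℓ♯) = 0`). Kerr–Schild 1965, §2. [cite: KerrSchild1965, §2] -/
theorem sum_inverseMetric_mul_nullCovectorFun (M a : ℝ) {x : E4} (hx : 0 < radius a x)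
    (ν : Fin 4) : ∑ μ, inverseMetric M a x μ ν * nullCovectorFun a x μ = nullVector a x ν := by
  simp only [inverseMetric_apply, sub_mul, Finset.sum_sub_distrib]
  have h1 : ∑ μ : Fin 4, (if μ = ν then (if μ = 0 then (-1 : ℝ) else 1) else 0) *
      nullCovectorFun a x μ = nullVector a x ν := by
    rw [nullVector_apply]
    fin_cases ν <;> simp
  have h2 : ∑ μ : Fin 4, 2 * scalarH M a x * nullVector a x ν * nullVector a x μ *
      nullCovectorFun a x μ = 2 * scalarH M a x * nullVector a x ν *
        ∑ μ, nullVector a x μ * nullCovectorFun a x μ := by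
    rw [Finset.mul_sum]
    refine Finset.sum_congr rfl fun μ _ ↦ by ring
  rw [h1, h2, sum_nullVector_mul_nullCovectorFun hx, mul_zero, sub_zero]

/-- The inverse metric is symmetric. [cite: KerrSchild1965, §2] -/
theorem inverseMetric_symm (M a : ℝ) (x : E4) (μ ν : Fin 4) :
    inverseMetric M a x μ ν = inverseMetric M a x ν μ := by
  rw [inverseMetric_apply, inverseMetric_apply]
  have : (if μ = ν then (if μ = 0 then (-1 : ℝ) else 1) else 0) =
      (if ν = μ then (if ν = 0 then (-1 : ℝ) else 1) else 0) := by
    by_cases h : μ = ν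
    · subst h; rfl
    · simp [h, Ne.symm h]
  rw [this]
  ring

/-- **Derivative of the metric components**: `∂_v g_{μν} = 2 (∂_v H) ℓ_μ ℓ_ν +
2H ((∂_v ℓ_μ) ℓ_ν + ℓ_μ (∂_v ℓ_ν))` wherever `r > 0` (product rule on
`g_{μν} = η_{μν} + 2H ℓ_μ ℓ_ν`). [cite: KerrSchild1965, §2] -/
theorem fderiv_bilin_basisVector (M a : ℝ) {x : E4} (hx : 0 < radius a x) (v : E4)
    (μ ν : Fin 4) :
    fderiv ℝ (bilin M a) x v (E4.basisVector μ) (E4.basisVector ν) =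
      2 * fderiv ℝ (scalarH M a) x v * nullCovectorFun a x μ * nullCovectorFun a x ν +
        2 * scalarH M a x * (fderiv ℝ (fun y ↦ nullCovectorFun a y μ) x v * nullCovectorFun a x ν +
          nullCovectorFun a x μ * fderiv ℝ (fun y ↦ nullCovectorFun a y ν) x v) := by
  have hd : DifferentiableAt ℝ (bilin M a) x :=
    (contDiffAt_bilin M a hx (n := 1)).differentiableAt one_ne_zero
  rw [← OpensChart.fderiv_apply₂ (bilin M a) hd]
  set f₁ : E4 → ℝ := fun y ↦ 2 * scalarH M a y
  set f₂ : E4 → ℝ := fun y ↦ nullCovectorFun a y μ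
  set f₃ : E4 → ℝ := fun y ↦ nullCovectorFun a y ν
  have hfun : (fun y ↦ bilin M a y (E4.basisVector μ) (E4.basisVector ν)) = fun y ↦
      etaComp μ ν + (f₁ * f₂ * f₃) y := by
    funext y; rw [bilin_basisVector]; rfl
  rw [hfun]
  have hH : HasFDerivAt (scalarH M a) (fderiv ℝ (scalarH M a) x) x :=
    ((contDiffAt_scalarH M a hx (n := 1)).differentiableAt one_ne_zero).hasFDerivAt
  have h1 : HasFDerivAt f₁ ((2 : ℝ) • fderiv ℝ (scalarH M a) x) x := hH.const_mul 2
  have h2 : HasFDerivAt f₂ (fderiv ℝ f₂ x) x :=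
    ((contDiffAt_nullCovectorFun a hx (n := 1) μ).differentiableAt one_ne_zero).hasFDerivAt
  have h3 : HasFDerivAt f₃ (fderiv ℝ f₃ x) x :=
    ((contDiffAt_nullCovectorFun a hx (n := 1) ν).differentiableAt one_ne_zero).hasFDerivAt
  have h := (((h1.mul h2).mul h3).const_add (etaComp μ ν)).fderiv
  rw [h]
  simp only [add_apply, smul_apply, smul_eq_mul, Pi.mul_apply]
  ring

/-- `∑_μ (ℓ♯)^μ ∂_v ℓ_μ = ½ ∂_v (ℓ(ℓ♯)) = 0`: the derivative of the identity `η⁻¹(ℓ, ℓ) = 0`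
(which holds on the open set `{r > 0}`). [cite: KerrSchild1965, §2] -/
theorem sum_nullVector_mul_fderiv_nullCovectorFun {a : ℝ} {x : E4} (hx : 0 < radius a x)
    (v : E4) : ∑ μ, nullVector a x μ * fderiv ℝ (fun y ↦ nullCovectorFun a y μ) x v = 0 := by
  -- `p(y) = ∑ sgn_μ ℓ_μ(y)² = ℓ(ℓ♯) = 0` near `x`
  set sgn : Fin 4 → ℝ := fun μ ↦ if μ = 0 then -1 else 1 with hsgn
  set f : Fin 4 → E4 → ℝ := fun μ y ↦ nullCovectorFun a y μ with hf
  have hp : (fun y ↦ ∑ μ, sgn μ * (f μ * f μ) y) =ᶠ[𝓝 x] fun _ ↦ (0 : ℝ) := by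
    have hopen : IsOpen {y : E4 | 0 < radius a y} :=
      isOpen_lt continuous_const (continuous_radius a)
    filter_upwards [hopen.mem_nhds hx] with y hy
    have h := sum_nullVector_mul_nullCovectorFun hy
    simp only [nullVector_apply] at h
    rw [← h]
    exact Finset.sum_congr rfl fun μ _ ↦ by simp only [hsgn, hf, Pi.mul_apply]; ring
  have hdf : ∀ μ, HasFDerivAt (f μ) (fderiv ℝ (f μ) x) x := fun μ ↦
    ((contDiffAt_nullCovectorFun a hx (n := 1) μ).differentiableAt one_ne_zero).hasFDerivAt
  have hsum : HasFDerivAt (fun y ↦ ∑ μ, sgn μ * (f μ * f μ) y)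
      (∑ μ, sgn μ • (f μ x • fderiv ℝ (f μ) x + f μ x • fderiv ℝ (f μ) x)) x :=
    HasFDerivAt.fun_sum fun μ _ ↦ ((hdf μ).mul (hdf μ)).const_mul (sgn μ)
  have hzero : HasFDerivAt (fun y ↦ ∑ μ, sgn μ * (f μ * f μ) y) (0 : E4 →L[ℝ] ℝ) x :=
    (hasFDerivAt_const (0 : ℝ) x).congr_of_eventuallyEq hp
  have heq := congrArg (fun L : E4 →L[ℝ] ℝ ↦ L v) (hsum.unique hzero)
  simp only [sum_apply, smul_apply, add_apply, smul_eq_mul, zero_apply] at heq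
  have hterm : ∀ μ, nullVector a x μ * fderiv ℝ (fun y ↦ nullCovectorFun a y μ) x v =
      (1 / 2 : ℝ) * (sgn μ * (f μ x * fderiv ℝ (f μ) x v + f μ x * fderiv ℝ (f μ) x v)) := by
    intro μ
    rw [nullVector_apply]
    simp only [hsgn, hf]
    ring
  simp only [hterm, ← Finset.mul_sum, heq, mul_zero]

/-- Finite-sum algebra behind the trace identity: contracting `2 dH l⊗l + 2H (dl⊗l + l⊗dl)` with a
symmetric `gI` for which `gI l = V`, `V·l = 0`, `V·dl = 0` gives zero. [folklore] -/
theorem trace_contract_aux (gI : Fin 4 → Fin 4 → ℝ) (l dl V : Fin 4 → ℝ) (dH H : ℝ)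
    (hl : ∀ ν, ∑ μ, gI μ ν * l μ = V ν) (hsym : ∀ μ ν, gI μ ν = gI ν μ)
    (hVl : ∑ μ, V μ * l μ = 0) (hVdl : ∑ μ, V μ * dl μ = 0) :
    ∑ μ, ∑ ν, gI μ ν * (2 * dH * l μ * l ν + 2 * H * (dl μ * l ν + l μ * dl ν)) = 0 := by
  have hl' : ∀ μ, ∑ ν, gI μ ν * l ν = V μ := by
    intro μ
    rw [← hl μ]
    exact Finset.sum_congr rfl fun ν _ ↦ by rw [hsym]
  have e1 : ∑ μ, ∑ ν, gI μ ν * (2 * dH * l μ * l ν) = 2 * dH * ∑ ν, V ν * l ν := by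
    rw [Finset.sum_comm, Finset.mul_sum]
    refine Finset.sum_congr rfl fun ν _ ↦ ?_
    rw [← hl ν, Finset.sum_mul, Finset.mul_sum]
    exact Finset.sum_congr rfl fun μ _ ↦ by ring
  have e2 : ∑ μ, ∑ ν, gI μ ν * (2 * H * (dl μ * l ν)) = 2 * H * ∑ μ, V μ * dl μ := by
    rw [Finset.mul_sum]
    refine Finset.sum_congr rfl fun μ _ ↦ ?_
    rw [← hl' μ, Finset.sum_mul, Finset.mul_sum]
    exact Finset.sum_congr rfl fun ν _ ↦ by ring
  have e3 : ∑ μ, ∑ ν, gI μ ν * (2 * H * (l μ * dl ν)) = 2 * H * ∑ ν, V ν * dl ν := by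
    rw [Finset.sum_comm, Finset.mul_sum]
    refine Finset.sum_congr rfl fun ν _ ↦ ?_
    rw [← hl ν, Finset.sum_mul, Finset.mul_sum]
    exact Finset.sum_congr rfl fun μ _ ↦ by ring
  have hsplit : ∀ μ ν, gI μ ν * (2 * dH * l μ * l ν + 2 * H * (dl μ * l ν + l μ * dl ν)) =
      gI μ ν * (2 * dH * l μ * l ν) + gI μ ν * (2 * H * (dl μ * l ν)) +
        gI μ ν * (2 * H * (l μ * dl ν)) := fun μ ν ↦ by ring
  simp only [hsplit, Finset.sum_add_distrib]
  rw [e1, e2, e3, hVl, hVdl]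
  ring

/-- **Unimodularity of Kerr–Schild coordinates**: `∑_{μν} g^{μν} ∂_v g_{μν} = 0` for every
direction `v`, wherever `r > 0`, i.e. `∂_v log |det g| = 0` (`det g = −1`; Kerr–Schild 1965, §2;
Visser arXiv:0706.0622, §5). Proof: contract `∂_v g = 2∂_vH ℓ⊗ℓ + 2H(∂_vℓ ⊗ ℓ + ℓ ⊗ ∂_vℓ)` with
`g⁻¹` using `g♯ℓ = ℓ♯`, `ℓ(ℓ♯) = 0` and `(∂_vℓ)(ℓ♯) = 0`. This is what makes the coordinate
divergence of a vector field equal to its covariant divergence (`Γ^μ_{μλ} = 0`).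
[cite: KerrSchild1965, §2] -/
theorem sum_inverseMetric_mul_fderiv_bilin (M a : ℝ) {x : E4} (hx : 0 < radius a x) (v : E4) :
    ∑ μ, ∑ ν, inverseMetric M a x μ ν *
      fderiv ℝ (bilin M a) x v (E4.basisVector μ) (E4.basisVector ν) = 0 := by
  simp only [fderiv_bilin_basisVector M a hx]
  exact trace_contract_aux (inverseMetric M a x) (nullCovectorFun a x)
    (fun μ ↦ fderiv ℝ (fun y ↦ nullCovectorFun a y μ) x v) (fun μ ↦ nullVector a x μ)
    (fderiv ℝ (scalarH M a) x v) (scalarH M a x)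
    (sum_inverseMetric_mul_nullCovectorFun M a hx) (inverseMetric_symm M a x)
    (sum_nullVector_mul_nullCovectorFun hx) (sum_nullVector_mul_fderiv_nullCovectorFun hx v)

/-! ### The divergence form of the wave operator -/

/-- The components `g^{μν}` of the inverse metric are `C^n` wherever `r > 0` (explicit formula
`η^{μν} − 2H ℓ^μ ℓ^ν`). [cite: KerrSchild1965, §2] -/
theorem contDiffAt_inverseMetric (M a : ℝ) {x : E4} (hx : 0 < radius a x) (μ ν : Fin 4)
    {n : WithTop ℕ∞} : ContDiffAt ℝ n (fun y ↦ inverseMetric M a y μ ν) x := by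
  have hfun : (fun y ↦ inverseMetric M a y μ ν) = fun y ↦
      etaComp μ ν - 2 * scalarH M a y * nullVector a y ν * nullVector a y μ := by
    funext y; rw [inverseMetric_apply]; rfl
  rw [hfun]
  have hV : ∀ κ, ContDiffAt ℝ n (fun y ↦ nullVector a y κ) x :=
    fun κ ↦ contDiffAt_euclidean.mp (contDiffAt_nullVector a hx) κ
  exact contDiffAt_const.sub (((contDiffAt_const.mul (contDiffAt_scalarH M a hx)).mul (hV ν)).mul
    (hV μ))

/-- `dx^μ(∂_κ) = δ^μ_κ` (dual bases). [folklore] -/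
theorem dx_basisVector (μ κ : Fin 4) :
    E4.dx μ (E4.basisVector κ) = if μ = κ then 1 else 0 := by
  simp [E4.basisVector]

/-- Expansion of the first slot of `g_x` in the coordinate basis: `g(u, w) = ∑ u^ν g(∂_ν, w)`.
[folklore] -/
theorem bilin_eq_sum_apply (M a : ℝ) (x u w : E4) :
    bilin M a x u w = ∑ ν, u ν * bilin M a x (E4.basisVector ν) w := by
  conv_lhs => rw [eq_sum_basisVector u, map_sum]
  rw [sum_apply]
  refine Finset.sum_congr rfl fun ν _ ↦ ?_
  rw [map_smul, smul_apply, smul_eq_mul]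

/-- `g♯(dx^μ)` has components `g^{νμ}` (the definition of `inverseMetric`). [cite: KerrSchild1965, §2] -/
theorem coSharp_dx_apply (M a : ℝ) (x : E4) (μ ν : Fin 4) :
    coSharp M a x ((E4.dx μ : E4 →L[ℝ] ℝ) : E4 →ₗ[ℝ] ℝ) ν = inverseMetric M a x ν μ := rfl

/-- **`g⁻¹ g = 1` in components**: `∑_ν g^{μν} g_{νκ} = δ^μ_κ` wherever `r > 0` (from
`Kerr.bilin_coSharp`). Kerr–Schild 1965, §2; O'Neill 1983, Ch. 3, proof of Prop. 10 ("`(g_{ij})` and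
`(g^{ij})` are inverse matrices"). [cite: KerrSchild1965, §2] -/
theorem sum_inverseMetric_mul_bilin (M a : ℝ) {x : E4} (hx : 0 < radius a x) (μ κ : Fin 4) :
    ∑ ν, inverseMetric M a x μ ν * bilin M a x (E4.basisVector ν) (E4.basisVector κ) =
      if μ = κ then 1 else 0 := by
  have h := bilin_coSharp M a hx ((E4.dx μ : E4 →L[ℝ] ℝ) : E4 →ₗ[ℝ] ℝ) (E4.basisVector κ)
  rw [bilin_eq_sum_apply] at h
  simp only [coSharp_dx_apply, ContinuousLinearMap.coe_coe, dx_basisVector] at h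
  rw [← h]
  exact Finset.sum_congr rfl fun ν _ ↦ by rw [inverseMetric_symm]

/-- **Derivative of the inverse metric**: `∑_ν (∂_v g^{μν}) g_{νκ} = −∑_ν g^{μν} ∂_v g_{νκ}`
(differentiate the constant function `g⁻¹ g = 1` on the open set `{r > 0}`). [folklore] -/
theorem sum_fderiv_inverseMetric_mul_bilin (M a : ℝ) {x : E4} (hx : 0 < radius a x) (v : E4)
    (μ κ : Fin 4) :
    ∑ ν, fderiv ℝ (fun y ↦ inverseMetric M a y μ ν) x v *
        bilin M a x (E4.basisVector ν) (E4.basisVector κ) =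
      -∑ ν, inverseMetric M a x μ ν *
        fderiv ℝ (bilin M a) x v (E4.basisVector ν) (E4.basisVector κ) := by
  set f : Fin 4 → E4 → ℝ := fun ν y ↦ inverseMetric M a y μ ν with hf
  set g : Fin 4 → E4 → ℝ := fun ν y ↦ bilin M a y (E4.basisVector ν) (E4.basisVector κ) with hg
  have hconst : (fun y ↦ ∑ ν, (f ν * g ν) y) =ᶠ[𝓝 x] fun _ ↦ (if μ = κ then (1 : ℝ) else 0) := by
    have hopen : IsOpen {y : E4 | 0 < radius a y} :=
      isOpen_lt continuous_const (continuous_radius a)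
    filter_upwards [hopen.mem_nhds hx] with y hy
    rw [← sum_inverseMetric_mul_bilin M a hy μ κ]
    rfl
  have hdf : ∀ ν, HasFDerivAt (f ν) (fderiv ℝ (f ν) x) x := fun ν ↦
    ((contDiffAt_inverseMetric M a hx μ ν (n := 1)).differentiableAt one_ne_zero).hasFDerivAt
  have hbil : DifferentiableAt ℝ (bilin M a) x :=
    (contDiffAt_bilin M a hx (n := 1)).differentiableAt one_ne_zero
  have hdg : ∀ ν, HasFDerivAt (g ν) (fderiv ℝ (g ν) x) x := fun ν ↦
    (OpensChart.differentiableAt_apply₂ (bilin M a) hbil _ _).hasFDerivAt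
  have hsum : HasFDerivAt (fun y ↦ ∑ ν, (f ν * g ν) y)
      (∑ ν, (f ν x • fderiv ℝ (g ν) x + g ν x • fderiv ℝ (f ν) x)) x :=
    HasFDerivAt.fun_sum fun ν _ ↦ (hdf ν).mul (hdg ν)
  have hzero : HasFDerivAt (fun y ↦ ∑ ν, (f ν * g ν) y) (0 : E4 →L[ℝ] ℝ) x :=
    (hasFDerivAt_const _ x).congr_of_eventuallyEq hconst
  have heq := congrArg (fun L : E4 →L[ℝ] ℝ ↦ L v) (hsum.unique hzero)
  simp only [sum_apply, smul_apply, add_apply, smul_eq_mul, zero_apply,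
    Finset.sum_add_distrib] at heq
  have hg' : ∀ ν, fderiv ℝ (g ν) x v =
      fderiv ℝ (bilin M a) x v (E4.basisVector ν) (E4.basisVector κ) :=
    fun ν ↦ OpensChart.fderiv_apply₂ (bilin M a) hbil _ _ v
  simp only [hg'] at heq
  have : ∑ ν, g ν x * fderiv ℝ (f ν) x v =
      ∑ ν, fderiv ℝ (fun y ↦ inverseMetric M a y μ ν) x v *
        bilin M a x (E4.basisVector ν) (E4.basisVector κ) :=
    Finset.sum_congr rfl fun ν _ ↦ by simp only [hf, hg]; ring
  rw [← this]
  linarith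

/-- **The contracted Christoffel symbols**: `g(∑ g^{μν} Γ(∂_ν, ∂_μ), ∂_κ) = ∑ g^{μν} ∂_μ g_{νκ}`;
of the three Koszul terms `∂_μ g_{νκ} + ∂_ν g_{κμ} − ∂_κ g_{μν}` the second equals the first by
symmetry and the third contracts to zero by unimodularity (`sum_inverseMetric_mul_fderiv_bilin`).
O'Neill 1983, Ch. 3, Prop. 13 (2) contracted with `g^{ij}`. [cite: ONeill1983, Ch. 3, Prop. 3.13] -/
theorem bilin_sum_christoffel [Facts] (M a r₀ : ℝ) (x : region a r₀) (κ : Fin 4) :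
    bilin M a x (∑ μ, ∑ ν, inverseMetric M a x μ ν •
      OpensChart.christoffel (smoothMetric M a r₀).toPseudoRiemannianMetric (bilin M a) x
        (E4.basisVector ν) (E4.basisVector μ)) (E4.basisVector κ) =
      ∑ μ, ∑ ν, inverseMetric M a x μ ν *
        fderiv ℝ (bilin M a) x (E4.basisVector μ) (E4.basisVector ν) (E4.basisVector κ) := by
  have hx := radius_pos_of_mem_region x.2
  have hbil : DifferentiableAt ℝ (bilin M a) x :=
    (contDiffAt_bilin M a hx (n := 1)).differentiableAt one_ne_zero
  rw [map_sum, sum_apply]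
  simp only [map_sum, sum_apply, map_smul, smul_apply,
    smul_eq_mul]
  -- each term: 2 g(Γ(e_ν e_μ), e_κ) = K
  have hK : ∀ μ ν, bilin M a x (OpensChart.christoffel
      (smoothMetric M a r₀).toPseudoRiemannianMetric (bilin M a) x
        (E4.basisVector ν) (E4.basisVector μ)) (E4.basisVector κ) =
      2⁻¹ * (fderiv ℝ (bilin M a) x (E4.basisVector μ) (E4.basisVector ν) (E4.basisVector κ) +
        fderiv ℝ (bilin M a) x (E4.basisVector ν) (E4.basisVector κ) (E4.basisVector μ) -
        fderiv ℝ (bilin M a) x (E4.basisVector κ) (E4.basisVector μ) (E4.basisVector ν)) := by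
    intro μ ν
    have h2 := OpensChart.two_mul_val_christoffel
      (g := (smoothMetric M a r₀).toPseudoRiemannianMetric) (G := bilin M a) x
      (E4.basisVector ν) (E4.basisVector μ) (E4.basisVector κ)
    rw [OpensChart.koszulForm_apply] at h2
    have h3 : (smoothMetric M a r₀).toPseudoRiemannianMetric.val x
        (OpensChart.christoffel (smoothMetric M a r₀).toPseudoRiemannianMetric (bilin M a) x
          (E4.basisVector ν) (E4.basisVector μ)) (E4.basisVector κ) =
        bilin M a x (OpensChart.christoffel (smoothMetric M a r₀).toPseudoRiemannianMetric
          (bilin M a) x (E4.basisVector ν) (E4.basisVector μ)) (E4.basisVector κ) := rfl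
    rw [h3] at h2
    linarith
  simp only [hK]
  -- split the three sums
  have hsym1 : ∀ μ ν, fderiv ℝ (bilin M a) x (E4.basisVector ν) (E4.basisVector κ)
      (E4.basisVector μ) = fderiv ℝ (bilin M a) x (E4.basisVector ν) (E4.basisVector μ)
        (E4.basisVector κ) := fun μ ν ↦ fderiv_bilin_symm M a hbil _ _ _
  simp only [hsym1]
  have htr := sum_inverseMetric_mul_fderiv_bilin M a hx (E4.basisVector κ)
  have hswap : ∑ μ, ∑ ν, inverseMetric M a x μ ν *
      fderiv ℝ (bilin M a) x (E4.basisVector ν) (E4.basisVector μ) (E4.basisVector κ) =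
      ∑ μ, ∑ ν, inverseMetric M a x μ ν *
        fderiv ℝ (bilin M a) x (E4.basisVector μ) (E4.basisVector ν) (E4.basisVector κ) := by
    rw [Finset.sum_comm]
    exact Finset.sum_congr rfl fun μ _ ↦ Finset.sum_congr rfl fun ν _ ↦ by
      rw [inverseMetric_symm]
  have hsplit : ∀ μ ν, inverseMetric M a x μ ν * (2⁻¹ *
      (fderiv ℝ (bilin M a) x (E4.basisVector μ) (E4.basisVector ν) (E4.basisVector κ) +
        fderiv ℝ (bilin M a) x (E4.basisVector ν) (E4.basisVector μ) (E4.basisVector κ) -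
        fderiv ℝ (bilin M a) x (E4.basisVector κ) (E4.basisVector μ) (E4.basisVector ν))) =
      2⁻¹ * (inverseMetric M a x μ ν *
        fderiv ℝ (bilin M a) x (E4.basisVector μ) (E4.basisVector ν) (E4.basisVector κ)) +
      2⁻¹ * (inverseMetric M a x μ ν *
        fderiv ℝ (bilin M a) x (E4.basisVector ν) (E4.basisVector μ) (E4.basisVector κ)) -
      2⁻¹ * (inverseMetric M a x μ ν *
        fderiv ℝ (bilin M a) x (E4.basisVector κ) (E4.basisVector μ) (E4.basisVector ν)) :=
    fun μ ν ↦ by ring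
  simp only [hsplit, Finset.sum_add_distrib, Finset.sum_sub_distrib, ← Finset.mul_sum]
  rw [hswap, htr]
  ring

/-- The coordinate divergence of the inverse metric, `c^ν = ∑_μ ∂_μ g^{μν}` (the first-order
coefficients of `□_g` in divergence form). [cite: KerrSchild1965, §2] -/
def divInverseMetric (M a : ℝ) (x : E4) (ν : Fin 4) : ℝ :=
  ∑ μ, fderiv ℝ (fun y ↦ inverseMetric M a y μ ν) x (E4.basisVector μ)

/-- **`∑ g^{μν} Γ^κ_{μν} ∂_κ = −∑ (∂_μ g^{μκ}) ∂_κ`**: the contracted Christoffel vector is minus the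
coordinate divergence of the inverse metric — the coordinate form of `Γ^κ_{μν} g^{μν} =
−|g|^{-1/2} ∂_μ(|g|^{1/2} g^{μκ})` with `|g| = 1` (Kerr–Schild 1965, §2: `det g = −1`).
[cite: KerrSchild1965, §2] -/
theorem sum_christoffel_eq [Facts] (M a r₀ : ℝ) (x : region a r₀) :
    (∑ μ, ∑ ν, inverseMetric M a x μ ν •
      OpensChart.christoffel (smoothMetric M a r₀).toPseudoRiemannianMetric (bilin M a) x
        (E4.basisVector ν) (E4.basisVector μ)) =
      -∑ ν, divInverseMetric M a x ν • E4.basisVector ν := by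
  have hx := radius_pos_of_mem_region x.2
  refine sub_eq_zero.mp (bilin_nondegenerate M a hx _ fun w ↦ ?_)
  rw [map_sub, sub_apply, sub_eq_zero]
  -- expand `w` in the basis on the second slot
  conv_lhs => rw [eq_sum_basisVector w, map_sum]
  conv_rhs => rw [eq_sum_basisVector w, map_sum]
  refine Finset.sum_congr rfl fun κ _ ↦ ?_
  rw [map_smul, map_smul]
  congr 1
  rw [bilin_sum_christoffel]
  -- right side
  rw [map_neg, neg_apply, map_sum, sum_apply]
  simp only [map_smul, smul_apply, smul_eq_mul, divInverseMetric,
    Finset.sum_mul]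
  conv_rhs => rw [Finset.sum_comm]
  rw [← Finset.sum_neg_distrib]
  refine Finset.sum_congr rfl fun μ _ ↦ ?_
  rw [sum_fderiv_inverseMetric_mul_bilin M a hx, neg_neg]

/-- **The wave operator of the Kerr metric in divergence form**: for `ψ : Kerr.region a r₀ → ℝ`
with a representative `Φ` of class `C²` at `x`,
`□_g ψ (x) = ∑_μ ∂_μ (∑_ν g^{μν} ∂_ν Φ)(x)`, `g^{μν} = η^{μν} − 2H ℓ^μ ℓ^ν` — the classical
`□_g = |g|^{-1/2} ∂_μ (|g|^{1/2} g^{μν} ∂_ν)` with `|g| = 1` in Kerr–Schild coordinates (Kerr–Schild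
1965, §2; Dafermos–Rodnianski–Shlapentokh-Rothman arXiv:1402.7034, §2.3: the energy identities of
gr.S24 are integrations of `(□_g ψ) Vψ`, for which this divergence form is the starting point).
Here `□_g` is the prelude's `PseudoRiemannianMetric.dalembertian` of `Kerr.smoothMetric M a r₀`.
[cite: KerrSchild1965, §2] -/
theorem dalembertian_eq_divergence [Facts] [SliceFacts] (M a r₀ : ℝ) {ψ : region a r₀ → ℝ}
    {Φ : E4 → ℝ} (hψ : ∀ y, ψ y = Φ y) (x : region a r₀) (hΦ : ContDiffAt ℝ 2 Φ x) :
    (smoothMetric M a r₀).toPseudoRiemannianMetric.dalembertian ψ x =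
      ∑ μ, fderiv ℝ (fun y ↦ ∑ ν, inverseMetric M a y μ ν * fderiv ℝ Φ y (E4.basisVector ν)) x
        (E4.basisVector μ) := by
  have hx := radius_pos_of_mem_region x.2
  rw [dalembertian_eq_sum M a r₀ hψ x hΦ]
  -- the first-order term
  have hΦ1 : DifferentiableAt ℝ Φ x := hΦ.differentiableAt (by norm_num)
  have hΦ2 : DifferentiableAt ℝ (fderiv ℝ Φ) x :=
    (hΦ.fderiv_right (m := 1) le_rfl).differentiableAt one_ne_zero
  have hfirst : ∑ μ, ∑ ν, inverseMetric M a x μ ν * fderiv ℝ Φ x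
      (OpensChart.christoffel (smoothMetric M a r₀).toPseudoRiemannianMetric (bilin M a) x
        (E4.basisVector ν) (E4.basisVector μ)) =
      -∑ ν, divInverseMetric M a x ν * fderiv ℝ Φ x (E4.basisVector ν) := by
    have h := congrArg (fderiv ℝ Φ x) (sum_christoffel_eq M a r₀ x)
    simp only [map_sum, map_smul, smul_eq_mul, map_neg] at h
    exact h
  -- the divergence, expanded by the product rule
  have hdiv : ∀ μ, fderiv ℝ (fun y ↦ ∑ ν, inverseMetric M a y μ ν *
      fderiv ℝ Φ y (E4.basisVector ν)) x (E4.basisVector μ) =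
      ∑ ν, (fderiv ℝ (fun y ↦ inverseMetric M a y μ ν) x (E4.basisVector μ) *
        fderiv ℝ Φ x (E4.basisVector ν) +
        inverseMetric M a x μ ν * fderiv ℝ (fderiv ℝ Φ) x (E4.basisVector μ)
          (E4.basisVector ν)) := by
    intro μ
    have hdf : ∀ ν, HasFDerivAt (fun y ↦ inverseMetric M a y μ ν)
        (fderiv ℝ (fun y ↦ inverseMetric M a y μ ν) x) x := fun ν ↦
      ((contDiffAt_inverseMetric M a hx μ ν (n := 1)).differentiableAt one_ne_zero).hasFDerivAt
    have hdΦ : ∀ ν, HasFDerivAt (fun y ↦ fderiv ℝ Φ y (E4.basisVector ν))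
        ((fderiv ℝ (fderiv ℝ Φ) x).flip (E4.basisVector ν)) x := by
      intro ν
      have := hΦ2.hasFDerivAt.clm_apply (hasFDerivAt_const (E4.basisVector ν) (x : E4))
      simpa using this
    have hsum := HasFDerivAt.fun_sum fun ν (_ : ν ∈ Finset.univ) ↦ (hdf ν).mul (hdΦ ν)
    rw [show (fun y ↦ ∑ ν, inverseMetric M a y μ ν * fderiv ℝ Φ y (E4.basisVector ν)) =
      fun y ↦ ∑ ν, ((fun y ↦ inverseMetric M a y μ ν) * fun y ↦ fderiv ℝ Φ y (E4.basisVector ν)) y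
      from rfl, hsum.fderiv]
    simp only [sum_apply, add_apply, smul_apply, smul_eq_mul, ContinuousLinearMap.flip_apply]
    exact Finset.sum_congr rfl fun ν _ ↦ by ring
  simp only [hdiv, Finset.sum_add_distrib, mul_sub, Finset.sum_sub_distrib]
  rw [hfirst]
  simp only [divInverseMetric, Finset.sum_mul, sub_neg_eq_add]
  rw [add_comm]
  congr 1
  rw [Finset.sum_comm]

/-- **Stationarity of the inverse metric**: `g^{μν}(x + t ∂_{t*}) = g^{μν}(x)`.
[cite: KerrSchild1965, §2] -/
theorem inverseMetric_add_smul_basisVector_zero (M a : ℝ) (x : E4) (t : ℝ) (μ ν : Fin 4) :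
    inverseMetric M a (x + t • E4.basisVector 0) μ ν = inverseMetric M a x μ ν := by
  rw [inverseMetric_apply, inverseMetric_apply, scalarH_add_smul_basisVector_zero,
    nullVector_add_smul_basisVector_zero]

/-- **`∂_{t*} g^{μν} = 0`** wherever the components are differentiable (in particular on
`{r > 0}`). [cite: KerrSchild1965, §2] -/
theorem fderiv_inverseMetric_basisVector_zero (M a : ℝ) {x : E4} (hx : 0 < radius a x)
    (μ ν : Fin 4) : fderiv ℝ (fun y ↦ inverseMetric M a y μ ν) x (E4.basisVector 0) = 0 := by
  have hd : DifferentiableAt ℝ (fun y ↦ inverseMetric M a y μ ν) x :=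
    (contDiffAt_inverseMetric M a hx μ ν (n := 1)).differentiableAt one_ne_zero
  have h1 : HasLineDerivAt ℝ (fun y ↦ inverseMetric M a y μ ν)
      (fderiv ℝ (fun y ↦ inverseMetric M a y μ ν) x (E4.basisVector 0)) x (E4.basisVector 0) :=
    hd.hasFDerivAt.hasLineDerivAt _
  have h2 : HasLineDerivAt ℝ (fun y ↦ inverseMetric M a y μ ν) 0 x (E4.basisVector 0) := by
    have : (fun t : ℝ ↦ inverseMetric M a (x + t • E4.basisVector 0) μ ν) =
        fun _ ↦ inverseMetric M a x μ ν :=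
      funext fun t ↦ inverseMetric_add_smul_basisVector_zero M a x t μ ν
    show HasDerivAt (fun t : ℝ ↦ inverseMetric M a (x + t • E4.basisVector 0) μ ν) 0 0
    rw [this]
    exact hasDerivAt_const (0 : ℝ) _
  exact h1.unique h2

end Literature.Geometry.Lorentzian.Kerr

end
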